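import Literature.Analysis.Calculus.LineIntegrationBootstrapChambers   -- ★ (d1‴) p846521: the three trimmed-chamber bootstraps (S), (D⁺), (D⁻)
import HarnessLib

/-!
# From a UNIFORM LOSS in the nearest singular wall to BOUNDED JETS on the six Weyl chambers `C_σ = {θ_{σ0} < θ_{σ1} < θ_{σ2}}` near `0`
# (ROAD «A6-IV» brick (d2) FILE 3a; Harish-Chandra ∕ Warner II, proof of Thm. 8.4.3.1 — the chamber bookkeeping over ★ (d1‴))

Topic `Analysis/Calculus`; namespace `Literature.Analysis.Calculus.LineBootstrap`.  THEOREMS ONLY (no `def`, no instance, no notation, no axiom, no named fact, no `sorry`).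
Cell `pub/hodgecm-mathlib`, ENGINE T1 (crux H413 = `stmt-HodgeConjecture-24833`); ROAD A, design of record `DESIGN-A6-InHouse-v2-ArchitectureIV` 93542b84 (LEAD T11-4), owner words R-15.9∕R-15.10
((d2) plan); author F0P3a-p05 (g15) (ROAD A owner), 2026-09-01.  Generic calculus on `ℝ³`; pays nothing by itself.

THE MATHEMATICS.  Coordinates `θ : Fin 3 → ℝ` (sup norm); the singular walls are `θ₂ = θ₀` and `θ₂ = θ₁`, and `m(θ) = min(|θ₀−θ₂|, |θ₁−θ₂|)` is the distance-like modulus to the nearest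
singular wall.  INPUT (what (c3′) + the Harish-Chandra reduction ★ `norm_iteratedFDeriv_liePhi_le_of_orders_lt_four` deliver): `φ` smooth on an open `U` containing the regular points of
the unit ball, and for EVERY order `n` a constant `C_n` with `‖Dⁿφ(θ)‖ ≤ C_n · m(θ)^{−N}` at all regular `θ` with `‖θ‖ < 1` — ONE exponent `N` for all orders.
OUTPUT: for every permutation `σ` of `{0,1,2}` and every `n`, `‖Dⁿφ‖` is BOUNDED on `C_σ ∩ B(0, 1∕4)`, `C_σ = {θ_{σ0} < θ_{σ1} < θ_{σ2}}` (the chamber token of ★ `of_chamberJetBounds_local`).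
PROOF: `δ = 1∕2`.  The position of the index `2` in `σ` sorts the six chambers into the three types of ★ (d1‴): `σ1 = 2` ⇒ type (S) `θ_a < θ₂ < θ_b` with `m = min(θ₂−θ_a, θ_b−θ₂)` and
`m^{−N} ≤ (θ₂−θ_a)^{−N}(θ_b−θ₂)^{−N}` on the trimmed chamber (both moduli `≤ δ ≤ 1`); `σ2 = 2` ⇒ type (D⁺) with `m = θ₂−θ_b` exactly; `σ0 = 2` ⇒ type (D⁻) with `m = θ_a−θ₂` exactly; the trimmed
chambers lie in `B(0, 2δ) = B(0,1)` and consist of regular points, and contain `C ∩ B(0, δ∕2) = C ∩ B(0, 1∕4)` (★ (d1‴) `chamber*_subset_ball`, `chamber*_inter_ball_subset`).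
HONEST LABEL: HC_CM is proved only modulo the printed citations until rung 0 closes.

## References
* [WarnerHASSLG2] G. Warner, *Harmonic Analysis on Semi-Simple Lie Groups II*, Grundlehren 189 (1972), §8.4.3, proof of Thm. 8.4.3.1; §8.4.1 (chambers cut by the singular roots).
* [Rudin1976] W. Rudin, *Principles of Mathematical Analysis*, 3rd ed. (1976), Thm. 9.21.
-/

set_option autoImplicit false

noncomputable section

open Set Metric

open scoped ContDiff

namespace Literature.Analysis.Calculus.LineBootstrap

variable {E : Type*} [NormedAddCommGroup E] [NormedSpace ℝ E]

/-! ### §1 Arithmetic of the nearest-wall modulus -/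

section Modulus

/-- For `0 < x`, `0 < y ≤ 1`: `(min x y)^{−N} ≤ x^{−N} · y^{−N}`. [cite: Rudin1976, Thm. 9.21] -/
theorem inv_pow_min_le_mul {x y : ℝ} (hx : 0 < x) (hy : 0 < y) (hx1 : x ≤ 1) (hy1 : y ≤ 1) (N : ℕ) :
    ((min x y) ^ N)⁻¹ ≤ (x ^ N)⁻¹ * (y ^ N)⁻¹ := by
  have hxN : 0 < x ^ N := pow_pos hx N
  have hyN : 0 < y ^ N := pow_pos hy N
  have hxN1 : x ^ N ≤ 1 := pow_le_one₀ hx.le hx1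
  have hyN1 : y ^ N ≤ 1 := pow_le_one₀ hy.le hy1
  rw [← mul_inv, inv_le_inv₀ (pow_pos (lt_min hx hy) N) (mul_pos hxN hyN)]
  rcases le_total x y with h | h
  · rw [min_eq_left h]
    calc x ^ N * y ^ N ≤ x ^ N * 1 := by gcongr
      _ = x ^ N := mul_one _
  · rw [min_eq_right h]
    calc x ^ N * y ^ N ≤ 1 * y ^ N := by gcongr
      _ = y ^ N := one_mul _

/-- `{a,b} = {0,1}` when `a ≠ b` are both `≠ 2`. [cite: Rudin1976, Thm. 9.21] -/
theorem eq_zero_one_or_of_ne_two (a b : Fin 3) (hab : a ≠ b) (ha : a ≠ 2) (hb : b ≠ 2) : (a = 0 ∧ b = 1) ∨ (a = 1 ∧ b = 0) := by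
  fin_cases a <;> fin_cases b <;> simp_all

/-- Type (S), `{a,b} = {0,1}`: on `θ_a < θ₂ < θ_b`, `min(|θ₀−θ₂|, |θ₁−θ₂|) = min(θ₂−θ_a, θ_b−θ₂)` and the coordinates are pairwise distinct. [cite: WarnerHASSLG2, §8.4.1] -/
theorem min_abs_eq_of_typeS (a b : Fin 3) (hab : a ≠ b) (ha : a ≠ 2) (hb : b ≠ 2) (θ : Fin 3 → ℝ) (h1 : θ a < θ 2) (h2 : θ 2 < θ b) :
    min |θ 0 - θ 2| |θ 1 - θ 2| = min (θ 2 - θ a) (θ b - θ 2) ∧ (θ 0 ≠ θ 1 ∧ θ 0 ≠ θ 2 ∧ θ 1 ≠ θ 2) := by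
  rcases eq_zero_one_or_of_ne_two a b hab ha hb with ⟨rfl, rfl⟩ | ⟨rfl, rfl⟩
  · refine ⟨?_, (h1.trans h2).ne, h1.ne, h2.ne'⟩
    rw [abs_of_neg (by linarith), abs_of_pos (by linarith), neg_sub]
  · refine ⟨?_, (h1.trans h2).ne', h2.ne', h1.ne⟩
    rw [abs_of_pos (by linarith), abs_of_neg (by linarith), neg_sub, min_comm]

/-- Type (D⁺), `{a,b} = {0,1}`: on `θ_a < θ_b < θ₂`, `min(|θ₀−θ₂|, |θ₁−θ₂|) = θ₂ − θ_b`, coordinates pairwise distinct. [cite: WarnerHASSLG2, §8.4.1] -/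
theorem min_abs_eq_of_typeDplus (a b : Fin 3) (hab : a ≠ b) (ha : a ≠ 2) (hb : b ≠ 2) (θ : Fin 3 → ℝ) (h1 : θ a < θ b) (h2 : θ b < θ 2) :
    min |θ 0 - θ 2| |θ 1 - θ 2| = θ 2 - θ b ∧ (θ 0 ≠ θ 1 ∧ θ 0 ≠ θ 2 ∧ θ 1 ≠ θ 2) := by
  rcases eq_zero_one_or_of_ne_two a b hab ha hb with ⟨rfl, rfl⟩ | ⟨rfl, rfl⟩
  · refine ⟨?_, h1.ne, (h1.trans h2).ne, h2.ne⟩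
    rw [abs_of_neg (by linarith), abs_of_neg (by linarith), neg_sub, neg_sub, min_eq_right (by linarith)]
  · refine ⟨?_, h1.ne', h2.ne, (h1.trans h2).ne⟩
    rw [abs_of_neg (by linarith), abs_of_neg (by linarith), neg_sub, neg_sub, min_eq_left (by linarith)]

/-- Type (D⁻), `{a,b} = {0,1}`: on `θ₂ < θ_a < θ_b`, `min(|θ₀−θ₂|, |θ₁−θ₂|) = θ_a − θ₂`, coordinates pairwise distinct. [cite: WarnerHASSLG2, §8.4.1] -/
theorem min_abs_eq_of_typeDminus (a b : Fin 3) (hab : a ≠ b) (ha : a ≠ 2) (hb : b ≠ 2) (θ : Fin 3 → ℝ) (h1 : θ 2 < θ a) (h2 : θ a < θ b) :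
    min |θ 0 - θ 2| |θ 1 - θ 2| = θ a - θ 2 ∧ (θ 0 ≠ θ 1 ∧ θ 0 ≠ θ 2 ∧ θ 1 ≠ θ 2) := by
  rcases eq_zero_one_or_of_ne_two a b hab ha hb with ⟨rfl, rfl⟩ | ⟨rfl, rfl⟩
  · refine ⟨?_, h2.ne, h1.ne', (h1.trans h2).ne'⟩
    rw [abs_of_pos (by linarith), abs_of_pos (by linarith), min_eq_left (by linarith)]
  · refine ⟨?_, h2.ne', (h1.trans h2).ne', h1.ne'⟩
    rw [abs_of_pos (by linarith), abs_of_pos (by linarith), min_eq_right (by linarith)]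

end Modulus

/-! ### §2 The three types at `δ = 1∕2` -/

section Types

variable (φ : (Fin 3 → ℝ) → E) {U : Set (Fin 3 → ℝ)}

/-- **TYPE (S)**: `θ_a < θ₂ < θ_b`, `{a,b} = {0,1}`. [cite: WarnerHASSLG2, §8.4.3, proof of Thm. 8.4.3.1] -/
theorem typeS_bounded_of_uniform_loss (a b : Fin 3) (hab : a ≠ b) (ha : a ≠ 2) (hb : b ≠ 2) (hU : IsOpen U) (hφ : ContDiffOn ℝ ∞ φ U)
    (hUreg : {θ : Fin 3 → ℝ | θ 0 ≠ θ 1 ∧ θ 0 ≠ θ 2 ∧ θ 1 ≠ θ 2} ∩ ball 0 1 ⊆ U) (N : ℕ)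
    (h : ∀ n : ℕ, ∃ C : ℝ, 0 ≤ C ∧ ∀ θ : Fin 3 → ℝ, (θ 0 ≠ θ 1 ∧ θ 0 ≠ θ 2 ∧ θ 1 ≠ θ 2) → ‖θ‖ < 1 →
      ‖iteratedFDeriv ℝ n φ θ‖ ≤ C * ((min |θ 0 - θ 2| |θ 1 - θ 2|) ^ N)⁻¹) (n : ℕ) :
    ∃ M : ℝ, ∀ θ ∈ {θ : Fin 3 → ℝ | θ a < θ 2 ∧ θ 2 < θ b} ∩ ball 0 (1 / 4), ‖iteratedFDeriv ℝ n φ θ‖ ≤ M := by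
  have hδ : (0 : ℝ) < 1 / 2 := by norm_num
  set T : Set (Fin 3 → ℝ) := {θ : Fin 3 → ℝ | θ a < θ 2 ∧ θ 2 < θ b ∧ θ 2 - θ a ≤ 1 / 2 ∧ θ b - θ 2 ≤ 1 / 2 ∧ |θ 2| < 1 / 2} with hT
  have hTreg : ∀ θ ∈ T, (θ 0 ≠ θ 1 ∧ θ 0 ≠ θ 2 ∧ θ 1 ≠ θ 2) ∧ ‖θ‖ < 1 := fun θ hθ =>
    ⟨(min_abs_eq_of_typeS a b hab ha hb θ hθ.1 hθ.2.1).2, by have := chamberS_subset_ball a b ha hb hab hδ hθ; rw [mem_ball_zero_iff] at this; linarith⟩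
  have hTU : T ⊆ U := fun θ hθ => hUreg ⟨(hTreg θ hθ).1, mem_ball_zero_iff.2 (hTreg θ hθ).2⟩
  have hloss : ∀ n : ℕ, ∃ C : ℝ, 0 ≤ C ∧ ∀ θ ∈ T, ‖iteratedFDeriv ℝ n φ θ‖ ≤ C * ((θ 2 - θ a) ^ N)⁻¹ * ((θ b - θ 2) ^ N)⁻¹ := by
    intro n
    obtain ⟨C, hC0, hC⟩ := h n
    refine ⟨C, hC0, fun θ hθ => (hC θ (hTreg θ hθ).1 (hTreg θ hθ).2).trans ?_⟩
    rw [(min_abs_eq_of_typeS a b hab ha hb θ hθ.1 hθ.2.1).1, mul_assoc]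
    exact mul_le_mul_of_nonneg_left (inv_pow_min_le_mul (by linarith [hθ.1]) (by linarith [hθ.2.1]) (by linarith [hθ.2.2.1]) (by linarith [hθ.2.2.2.1]) N) hC0
  obtain ⟨M, -, hM⟩ := chamberS_forall_norm_iteratedFDeriv_bounded a b hab ha hb hδ φ hU hφ hTU N N hloss n
  refine ⟨M, fun θ hθ => hM θ (chamberS_inter_ball_subset a b hδ ?_)⟩
  simpa only [show (1 : ℝ) / 2 / 2 = 1 / 4 by norm_num] using hθ

/-- **TYPE (D⁺)**: `θ_a < θ_b < θ₂`, `{a,b} = {0,1}`. [cite: WarnerHASSLG2, §8.4.3, proof of Thm. 8.4.3.1] -/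
theorem typeDplus_bounded_of_uniform_loss (a b : Fin 3) (hab : a ≠ b) (ha : a ≠ 2) (hb : b ≠ 2) (hU : IsOpen U) (hφ : ContDiffOn ℝ ∞ φ U)
    (hUreg : {θ : Fin 3 → ℝ | θ 0 ≠ θ 1 ∧ θ 0 ≠ θ 2 ∧ θ 1 ≠ θ 2} ∩ ball 0 1 ⊆ U) (N : ℕ)
    (h : ∀ n : ℕ, ∃ C : ℝ, 0 ≤ C ∧ ∀ θ : Fin 3 → ℝ, (θ 0 ≠ θ 1 ∧ θ 0 ≠ θ 2 ∧ θ 1 ≠ θ 2) → ‖θ‖ < 1 →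
      ‖iteratedFDeriv ℝ n φ θ‖ ≤ C * ((min |θ 0 - θ 2| |θ 1 - θ 2|) ^ N)⁻¹) (n : ℕ) :
    ∃ M : ℝ, ∀ θ ∈ {θ : Fin 3 → ℝ | θ a < θ b ∧ θ b < θ 2} ∩ ball 0 (1 / 4), ‖iteratedFDeriv ℝ n φ θ‖ ≤ M := by
  have hδ : (0 : ℝ) < 1 / 2 := by norm_num
  set T : Set (Fin 3 → ℝ) := {θ : Fin 3 → ℝ | θ a < θ b ∧ θ b < θ 2 ∧ θ 2 - θ b ≤ 1 / 2 ∧ |θ a| < 1 / 2 ∧ |θ b| < 1 / 2} with hT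
  have hTreg : ∀ θ ∈ T, (θ 0 ≠ θ 1 ∧ θ 0 ≠ θ 2 ∧ θ 1 ≠ θ 2) ∧ ‖θ‖ < 1 := fun θ hθ =>
    ⟨(min_abs_eq_of_typeDplus a b hab ha hb θ hθ.1 hθ.2.1).2, by have := chamberDplus_subset_ball a b ha hb hab hδ hθ; rw [mem_ball_zero_iff] at this; linarith⟩
  have hTU : T ⊆ U := fun θ hθ => hUreg ⟨(hTreg θ hθ).1, mem_ball_zero_iff.2 (hTreg θ hθ).2⟩
  have hloss : ∀ n : ℕ, ∃ C : ℝ, 0 ≤ C ∧ ∀ θ ∈ T, ‖iteratedFDeriv ℝ n φ θ‖ ≤ C * ((θ 2 - θ b) ^ N)⁻¹ * ((θ 2 - θ a) ^ 0)⁻¹ := by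
    intro n
    obtain ⟨C, hC0, hC⟩ := h n
    refine ⟨C, hC0, fun θ hθ => (hC θ (hTreg θ hθ).1 (hTreg θ hθ).2).trans (le_of_eq ?_)⟩
    rw [(min_abs_eq_of_typeDplus a b hab ha hb θ hθ.1 hθ.2.1).1, pow_zero, inv_one, mul_one]
  obtain ⟨M, -, hM⟩ := chamberDplus_forall_norm_iteratedFDeriv_bounded a b ha hb hδ φ hU hφ hTU N 0 hloss n
  refine ⟨M, fun θ hθ => hM θ (chamberDplus_inter_ball_subset a b hδ ?_)⟩
  simpa only [show (1 : ℝ) / 2 / 2 = 1 / 4 by norm_num] using hθ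

/-- **TYPE (D⁻)**: `θ₂ < θ_a < θ_b`, `{a,b} = {0,1}`. [cite: WarnerHASSLG2, §8.4.3, proof of Thm. 8.4.3.1] -/
theorem typeDminus_bounded_of_uniform_loss (a b : Fin 3) (hab : a ≠ b) (ha : a ≠ 2) (hb : b ≠ 2) (hU : IsOpen U) (hφ : ContDiffOn ℝ ∞ φ U)
    (hUreg : {θ : Fin 3 → ℝ | θ 0 ≠ θ 1 ∧ θ 0 ≠ θ 2 ∧ θ 1 ≠ θ 2} ∩ ball 0 1 ⊆ U) (N : ℕ)
    (h : ∀ n : ℕ, ∃ C : ℝ, 0 ≤ C ∧ ∀ θ : Fin 3 → ℝ, (θ 0 ≠ θ 1 ∧ θ 0 ≠ θ 2 ∧ θ 1 ≠ θ 2) → ‖θ‖ < 1 →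
      ‖iteratedFDeriv ℝ n φ θ‖ ≤ C * ((min |θ 0 - θ 2| |θ 1 - θ 2|) ^ N)⁻¹) (n : ℕ) :
    ∃ M : ℝ, ∀ θ ∈ {θ : Fin 3 → ℝ | θ 2 < θ a ∧ θ a < θ b} ∩ ball 0 (1 / 4), ‖iteratedFDeriv ℝ n φ θ‖ ≤ M := by
  have hδ : (0 : ℝ) < 1 / 2 := by norm_num
  set T : Set (Fin 3 → ℝ) := {θ : Fin 3 → ℝ | θ 2 < θ a ∧ θ a < θ b ∧ θ a - θ 2 ≤ 1 / 2 ∧ |θ a| < 1 / 2 ∧ |θ b| < 1 / 2} with hT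
  have hTreg : ∀ θ ∈ T, (θ 0 ≠ θ 1 ∧ θ 0 ≠ θ 2 ∧ θ 1 ≠ θ 2) ∧ ‖θ‖ < 1 := fun θ hθ =>
    ⟨(min_abs_eq_of_typeDminus a b hab ha hb θ hθ.1 hθ.2.1).2, by have := chamberDminus_subset_ball a b ha hb hab hδ hθ; rw [mem_ball_zero_iff] at this; linarith⟩
  have hTU : T ⊆ U := fun θ hθ => hUreg ⟨(hTreg θ hθ).1, mem_ball_zero_iff.2 (hTreg θ hθ).2⟩
  have hloss : ∀ n : ℕ, ∃ C : ℝ, 0 ≤ C ∧ ∀ θ ∈ T, ‖iteratedFDeriv ℝ n φ θ‖ ≤ C * ((θ a - θ 2) ^ N)⁻¹ * ((θ b - θ 2) ^ 0)⁻¹ := by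
    intro n
    obtain ⟨C, hC0, hC⟩ := h n
    refine ⟨C, hC0, fun θ hθ => (hC θ (hTreg θ hθ).1 (hTreg θ hθ).2).trans (le_of_eq ?_)⟩
    rw [(min_abs_eq_of_typeDminus a b hab ha hb θ hθ.1 hθ.2.1).1, pow_zero, inv_one, mul_one]
  obtain ⟨M, -, hM⟩ := chamberDminus_forall_norm_iteratedFDeriv_bounded a b ha hb hδ φ hU hφ hTU N 0 hloss n
  refine ⟨M, fun θ hθ => hM θ (chamberDminus_inter_ball_subset a b hδ ?_)⟩
  simpa only [show (1 : ℝ) / 2 / 2 = 1 / 4 by norm_num] using hθ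

end Types

/-! ### §3 The six permutation chambers -/

section Weyl

/-- **BOUNDED JETS ON EVERY WEYL CHAMBER FROM A UNIFORM NEAREST-WALL LOSS.**  `φ` smooth on an open `U` containing the regular points of the unit ball; if for every order `n` there is `C_n` with
`‖Dⁿφ(θ)‖ ≤ C_n · (min(|θ₀−θ₂|, |θ₁−θ₂|))^{−N}` at all regular `θ` with `‖θ‖ < 1` (ONE `N` for all `n`), then for every permutation `σ` and every `n`, `‖Dⁿφ‖` is bounded on
`{θ_{σ0} < θ_{σ1} < θ_{σ2}} ∩ B(0, 1∕4)`. [cite: WarnerHASSLG2, §8.4.3, proof of Thm. 8.4.3.1] -/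
theorem weylChamber_norm_iteratedFDeriv_bounded_of_uniform_loss (φ : (Fin 3 → ℝ) → E) {U : Set (Fin 3 → ℝ)} (hU : IsOpen U) (hφ : ContDiffOn ℝ ∞ φ U)
    (hUreg : {θ : Fin 3 → ℝ | θ 0 ≠ θ 1 ∧ θ 0 ≠ θ 2 ∧ θ 1 ≠ θ 2} ∩ ball 0 1 ⊆ U) (N : ℕ)
    (h : ∀ n : ℕ, ∃ C : ℝ, 0 ≤ C ∧ ∀ θ : Fin 3 → ℝ, (θ 0 ≠ θ 1 ∧ θ 0 ≠ θ 2 ∧ θ 1 ≠ θ 2) → ‖θ‖ < 1 →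
      ‖iteratedFDeriv ℝ n φ θ‖ ≤ C * ((min |θ 0 - θ 2| |θ 1 - θ 2|) ^ N)⁻¹)
    (σ : Equiv.Perm (Fin 3)) (n : ℕ) :
    ∃ M : ℝ, ∀ θ ∈ {θ : Fin 3 → ℝ | θ (σ 0) < θ (σ 1) ∧ θ (σ 1) < θ (σ 2)} ∩ ball 0 (1 / 4), ‖iteratedFDeriv ℝ n φ θ‖ ≤ M := by
  have hinj := σ.injective
  have h01 : σ 0 ≠ σ 1 := fun e => absurd (hinj e) (by decide)
  have h12 : σ 1 ≠ σ 2 := fun e => absurd (hinj e) (by decide)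
  have h02 : σ 0 ≠ σ 2 := fun e => absurd (hinj e) (by decide)
  have key : σ 0 = 2 ∨ σ 1 = 2 ∨ σ 2 = 2 := by
    obtain ⟨i, hi⟩ := σ.surjective 2
    fin_cases i
    · exact Or.inl hi
    · exact Or.inr (Or.inl hi)
    · exact Or.inr (Or.inr hi)
  rcases key with h0 | h1 | h2
  · -- `σ0 = 2`: type (D⁻) with `a = σ1`, `b = σ2`
    have ha : σ 1 ≠ 2 := fun e => h01 (h0.trans e.symm)
    have hb : σ 2 ≠ 2 := fun e => h02 (h0.trans e.symm)
    obtain ⟨M, hM⟩ := typeDminus_bounded_of_uniform_loss φ (σ 1) (σ 2) h12 ha hb hU hφ hUreg N h n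
    refine ⟨M, fun θ hθ => hM θ ⟨?_, hθ.2⟩⟩
    have hc := hθ.1
    simp only [mem_setOf_eq] at hc ⊢
    rw [h0] at hc
    exact hc
  · -- `σ1 = 2`: type (S) with `a = σ0`, `b = σ2`
    have ha : σ 0 ≠ 2 := fun e => h01 (e.trans h1.symm)
    have hb : σ 2 ≠ 2 := fun e => h12 (h1.trans e.symm)
    obtain ⟨M, hM⟩ := typeS_bounded_of_uniform_loss φ (σ 0) (σ 2) h02 ha hb hU hφ hUreg N h n
    refine ⟨M, fun θ hθ => hM θ ⟨?_, hθ.2⟩⟩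
    have hc := hθ.1
    simp only [mem_setOf_eq] at hc ⊢
    rw [h1] at hc
    exact hc
  · -- `σ2 = 2`: type (D⁺) with `a = σ0`, `b = σ1`
    have ha : σ 0 ≠ 2 := fun e => h02 (e.trans h2.symm)
    have hb : σ 1 ≠ 2 := fun e => h12 (e.trans h2.symm)
    obtain ⟨M, hM⟩ := typeDplus_bounded_of_uniform_loss φ (σ 0) (σ 1) h01 ha hb hU hφ hUreg N h n
    refine ⟨M, fun θ hθ => hM θ ⟨?_, hθ.2⟩⟩
    have hc := hθ.1
    simp only [mem_setOf_eq] at hc ⊢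
    rw [h2] at hc
    exact hc

end Weyl

end Literature.Analysis.Calculus.LineBootstrap

end
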